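import Literature.AlgebraicGeometry.HodgeTheory.WeilClassesFourfolds
import Literature.AlgebraicGeometry.HodgeTheory.LefschetzOneOne
import HarnessLib

/-!
# The Hodge conjecture for complex abelian varieties of dimension `≤ 5` (Markman 2025, Cor. 1.3)

Family `hodge`, layer `Literature/AlgebraicGeometry/HodgeTheory`. A KNOWN CASE of the Hodge
conjecture, stated on the real carriers of this layer (`complexBetti`, `IsRationalClass`,
`IsOfHodgeType`, `algebraicClasses`) and on the tree's bundled abelian varieties
`Motives.AbelianVariety ℂ` (`A.dim = Motives.schemeDim A.X.left`), in the pattern of the sibling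
known-case files `LefschetzOneOne` (`hodgeClasses_algebraic_of_dim_le_three`), `WeilClassesFourfolds`
(`Markman2025_weilClasses_algebraic_abelianFourfold`), `FermatHodgeConjecture`,
`CubicFourfoldHodgeConjecture`.

Source READ (held, `paper:arxiv-2509.23403`, text chunk 4): E. Markman, *Secant sheaves and Weil
classes on abelian varieties*, arXiv:2509.23403 (2025) [`Markman2025SurveySecant`], §1.1, verbatim:

> "The Hodge conjecture is known for projective varieties of dimension `≤ 3`. The Hodge ring of
> abelian fourfolds is generated by divisor classes and Weil classes for complex multiplication by
> possibly more than one imaginary quadratic number field, by work of Moonen and Zarhin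
> [Moonen-Zarhin-Weil-Hodge-Tate-classes, moonen-zarhin-low-dimension] combined with a result of
> Ramón Marí in the case of products of abelian surfaces [ramon-mari]. The Hodge ring for simple
> abelian varieties of prime dimension is generated by divisor classes, by a result of Tankeev
> [tankeev]. If `X` is a non-simple abelian variety of dimension `5`, then the Hodge ring of `X` is
> generated by divisor classes and pull backs of Weil classes from quotient abelian fourfolds, by
> [moonen-zarhin-low-dimension]. Combining these results with Theorem 1.2 we get:
> **Corollary 1.3.** The Hodge conjecture holds for abelian varieties of dimension `≤ 5`."

(Theorem 1.2 ibid.: "The Weil classes for abelian fourfolds of Weil type and abelian sixfolds of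
split Weil type with complex multiplication by a quadratic imaginary number field `K` are
algebraic" — its fourfold half is the tree's `Markman2025_weilClasses_algebraic_abelianFourfold`,
file `WeilClassesFourfolds`; the proofs are in arXiv:2502.03415 [`Markman2025SecantWeil`].)

PRINT STATUS (page-read 2026-08-28, seat `hodgeav-lowdim-lit-1`, req-37 (A) Q2a): the survey has
appeared as E. Markman, *Secant sheaves and Weil classes on abelian varieties*, Proc. ICM 2026,
Vol. 3, SIAM, pp. 586–602, doi 10.1137/25m1803796 (= arXiv:2509.23403v2) [`Markman2026ICMSecant`],
with the same Thm. 1.2 and **Cor. 1.3** ("The Hodge conjecture holds for abelian varieties of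
dimension `≤ 5`"); and the statement is **Thm. 1.3** of C. Voisin, *La conjecture de Hodge pour les
variétés abéliennes de dimension au plus 5 [d'après Markman]*, Séminaire Bourbaki, 78e année,
Exp. n° 1248 (janvier 2026) [`Voisin2026BourbakiMarkman`], where Thm. 2.6 restates Moonen–Zarhin
1999 Thms. (0.1)–(0.2), Cor. 2.8 is the reduction "HC in dimension `≤ 5` ⟸ Weil classes on Weil
fourfolds", and Lemme 2.9 / Cor. 2.10 the product step from split Weil sixfolds. The load-bearing
input — algebraicity of the Weil classes on EVERY abelian fourfold of Weil type (all `K`, all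
discriminants) — is arXiv:2502.03415v2 Thm. 1.5.1 plus Schoen's product step, a PREPRINT carried by
the ICM lecture and the Bourbaki exposé (independent refereed proofs cover only the discriminant-`1`
fourfold components, `K = ℚ(√−3)` (Schoen 1988/1998) and `K = ℚ(i)` (Koike 2004)); the claim tag on
the fact below (`status: under-review`) is therefore KEPT. Moonen–Zarhin's item numbers used in this
layer are those of Math. Ann. 315 = arXiv:math/9901113v2 (Thm. (0.1) pp. 1–2, Thm. (0.2) pp. 2–3,
(1.9) Weil classes, (2.7) Tankeev, (5.12) conclusions).

## What is vendored, and faithfulness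

`Markman2025_hodgeClasses_algebraic_abelian_dim_le_five` (named fact, D-0014; tagged as an
unrefereed CLAIM, D-0012, because the source is a 2025 arXiv survey resting on the 2025 preprint
arXiv:2502.03415): for every complex abelian variety `A` with `A.dim ≤ 5` (and
`Motives.IsSmoothProjective A.dim A.X`, PROVABLE for every bundled abelian variety —
`Motives.AbelianVariety.isSmoothProjective_holds`, file `Motives/AbelianVarietyProjectiveChart` — but
kept as a hypothesis, as in `WeilClassesFourfolds`, so that this file's import cone stays that of
the sibling fact), every rational class `c ∈ H²ᵖ(A(ℂ); ℂ)` of Hodge type `(p, p)` is algebraic,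
`c ∈ algebraicClasses A.X p = Nᵖ H²ᵖ`, for EVERY `p` — the cycle part of `HodgeConjectureFor A.dim A.X`
(the anti-vacuity conjunct `Nonempty (HodgeModel _ _)` is the separate fact `nonempty_hodgeModel`;
`hodgeConjectureFor_abelian_of_dim_le_five_of` assembles the two).

* "abelian variety of dimension `≤ 5`" = `A : Motives.AbelianVariety ℂ` (proper geometrically
  integral group scheme over `ℂ`, Mumford §4) with `A.dim ≤ 5`; "the Hodge conjecture holds for
  `A`" = Deligne's statement for the smooth projective variety `A.X`, i.e. the inclusion
  "rational `(p,p)` ⇒ algebraic" in every degree `2p`, exactly as in the summit statement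
  (`HodgeConjectureFor`, module docstring of `HodgeConjecture`).
* As for every fact of this layer concluding algebraicity from `IsOfHodgeType`
  (`lefschetzOneOne_rational`, `hodgeClasses_algebraic_of_dim_le_three`,
  `Markman2025_weilClasses_algebraic_abelianFourfold`, …), the `∃`-over-Hodge-models convention of
  `IsOfHodgeType` is the standing one of the summit statement.
* Nothing stronger than the summit statement is claimed
  (`Markman2025_hodgeClasses_algebraic_abelian_dim_le_five_of_hodgeConjectureFor`), and the fact
  contains the two earlier known cases it subsumes on abelian varieties: the `dim ≤ 3` slice is the
  abelian instance of `hodgeClasses_algebraic_of_dim_le_three` (Voisin II, proof of Prop. 10.26;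
  `….of_dim_le_three`) and the fourfold Weil plane is `Markman2025_weilClasses_algebraic_abelianFourfold`
  (`Markman2025_weilClasses_algebraic_abelianFourfold_of_dim_le_five`).
* NOT vendored: the ingredients of the proof as separate facts — the Moonen–Zarhin classification of
  Hodge classes on abelian varieties of dimension `≤ 5` (Duke 1995 for simple fourfolds; Math. Ann.
  1999 in general: exceptional classes are Weil classes, resp. divisor classes times pull-backs of
  Weil classes from quotient fourfolds), Ramón Marí 2008 (products of surfaces), Tankeev (simple
  abelian varieties of prime dimension), and the sixfold half of Thm. 1.2 (split Weil sixfolds; see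
  the module docstring of `WeilClassesFourfolds` for why `Motives.weilDiscriminant` is needed first).
  The first OPEN case of the Hodge conjecture for abelian varieties in print is therefore dimension
  `6` (Weil classes on sixfolds of non-split Weil type, `2 ≤ p ≤ 4`).

Consumers: the logical-status files of the abelian nodes of route `HodgeConjecture/PadicSemiregularLift`
(`Theorems/PadicSemiregularLiftAbelianAnchorAssemblyLowDimension.lean`: granted the route's engine,
the glue node `AbelianAnchorAssembly` and the crux `HodgeAbelianVarieties` are exactly their part
`dim A ≥ 6`), and the negative-side bookkeeping `Theorems/HodgeAbelianVarieties/Negative/` ("a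
minimal counterexample has `dim A ≥ 4` (in print `≥ 6`: Markman, arXiv:2509.23403 Cor. 1.3)").

## References

* [Markman2025SurveySecant] E. Markman, Secant sheaves and Weil classes on abelian varieties,
  arXiv:2509.23403 (2025), §1.1, Thm. 1.2 and Cor. 1.3.
* [Markman2025SecantWeil] E. Markman, Cycles on abelian 2n-folds of Weil type from secant sheaves on
  abelian n-folds, arXiv:2502.03415 (2025), Thm. 1.5.1, Cor. 1.6.1.
* [Markman2026ICMSecant] E. Markman, Secant sheaves and Weil classes on abelian varieties, Proc.
  ICM 2026, Vol. 3 (SIAM, 2026), 586–602, doi 10.1137/25m1803796, Thm. 1.2 and Cor. 1.3.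
* [Voisin2026BourbakiMarkman] C. Voisin, La conjecture de Hodge pour les variétés abéliennes de
  dimension au plus 5 [d'après Markman], Sém. Bourbaki 78e année, Exp. 1248 (2026), Thm. 1.3,
  Thm. 2.6, Cor. 2.8, Lemme 2.9, Cor. 2.10.
* [MoonenZarhin1995Duke] B. Moonen, Yu. Zarhin, Hodge classes and Tate classes on simple abelian
  fourfolds, Duke Math. J. 77 (1995), 553–581.
* [MoonenZarhin1999LowDim] B. Moonen, Yu. Zarhin, Hodge classes on abelian varieties of low
  dimension, Math. Ann. 315 (1999), 711–733 (arXiv:math/9901113v2), Thm. (0.1) (dim `≤ 4`) and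
  Thm. (0.2) (dim `5`).
* [RamonMari2008] J. J. Ramón Marí, On the Hodge conjecture for products of certain surfaces,
  Collect. Math. 59 (2008), 1–26.
* S. G. Tankeev, Cycles on simple abelian varieties of prime dimension, Izv. Akad. Nauk SSSR 46
  (1982), 155–170 (Markman's [tankeev]; no separate statement is vendored here).
* [VoisinHodgeII2003] C. Voisin, Hodge Theory and Complex Algebraic Geometry II (CUP 2003), §10.2.3
  proof of Prop. 10.26 (dimension `≤ 3`).
* [Deligne2000] P. Deligne, The Hodge conjecture (Clay, 2000), §1.
-/

noncomputable section

open CategoryTheory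

namespace Literature.AlgebraicGeometry.HodgeTheory

open Literature.AlgebraicTopology.SingularHomology

section HodgeTheory

/-- **Markman 2025 (arXiv:2509.23403, Cor. 1.3): on a complex abelian variety of dimension `≤ 5`
every rational `(p,p)`-class is algebraic** (a THEOREM in print, the known low-dimensional case of
the summit statement; proved in print, not in the tree) — from Moonen–Zarhin (Hodge classes on
abelian varieties of dimension `≤ 5` are generated by divisor classes and (pull-backs of) Weil
classes of fourfolds of Weil type),
Ramón Marí (products of surfaces), Tankeev (simple, prime dimension) and Thm. 1.2 ibid. (Weil classes
on abelian fourfolds of Weil type are algebraic, arXiv:2502.03415 Cor. 1.6.1). Rendering: for `A` a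
complex abelian variety with `A.dim ≤ 5` (smooth projective of dimension `A.dim`, a provable guard),
every rational class of Hodge type `(p,p)` in `H²ᵖ(A(ℂ); ℂ)` lies in `algebraicClasses A.X p`, for
every `p` (the cycle part of the summit-layer statement for `A.X`). Source locator: arXiv:2509.23403,
§1.1, Corollary 1.3 (text chunk 4) — in print as Proc. ICM 2026 (doi 10.1137/25m1803796) Cor. 1.3
and as Thm. 1.3 of Voisin's Bourbaki Exp. 1248 (2026); the proof rests on the preprint
arXiv:2502.03415 (Thm. 1.5.1), hence still tagged as a claim.
[claim: Markman2025SurveySecant, status: under-review] -/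
def Markman2025_hodgeClasses_algebraic_abelian_dim_le_five : Prop :=
  ∀ (A : Motives.AbelianVariety ℂ), A.dim ≤ 5 → Motives.IsSmoothProjective A.dim A.X →
    ∀ (p : ℕ) (c : singularCohomology ℂ ℂ (Motives.ComplexPoints A.X) (2 * p)),
      IsRationalClass c → IsOfHodgeType A.dim A.X (2 * p) p p c → c ∈ algebraicClasses A.X p

/-! ### Upper bound: the fact is an instance of the Hodge conjecture -/

/-- The Hodge conjecture for all smooth projective varieties (spelled with `HodgeConjectureFor`)
implies the fact: it is its cycle part over abelian varieties of dimension `≤ 5` (nothing stronger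
than the summit statement is claimed). [cite: Deligne2000, §1] -/
theorem Markman2025_hodgeClasses_algebraic_abelian_dim_le_five_of_hodgeConjectureFor
    (h : ∀ ⦃n : ℕ⦄ ⦃X : Motives.SchemeOver ℂ⦄, Motives.IsSmoothProjective n X → HodgeConjectureFor n X) :
    Markman2025_hodgeClasses_algebraic_abelian_dim_le_five :=
  fun _ _ hX p c hc hpp ↦ (h hX).2 p c hc hpp

/-! ### Consequences -/

/-- **The Hodge conjecture for a complex abelian variety of dimension `≤ 5`, in the summit layer's
spelling**: with the fact and the existence of Hodge models (`nonempty_hodgeModel`, the anti-vacuity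
conjunct), `HodgeConjectureFor A.dim A.X` holds for every smooth projective abelian `A` with
`A.dim ≤ 5`. Source locator: arXiv:2509.23403 Cor. 1.3. [claim: Markman2025SurveySecant, status: under-review] -/
theorem hodgeConjectureFor_abelian_of_dim_le_five_of
    (h : Markman2025_hodgeClasses_algebraic_abelian_dim_le_five) (A : Motives.AbelianVariety ℂ)
    (hM : nonempty_hodgeModel A.dim A.X) (hd : A.dim ≤ 5) (hX : Motives.IsSmoothProjective A.dim A.X) :
    HodgeConjectureFor A.dim A.X :=
  ⟨hM hX, fun p c hc hpp ↦ h A hd hX p c hc hpp⟩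

/-- The fourfold Weil-plane fact of `WeilClassesFourfolds` is an instance of the `dim ≤ 5` fact
(consistency of the two vendored statements of the same source: Thm. 1.2, fourfold half, is the
Weil-plane slice of Cor. 1.3 in dimension `4 = 2 · 2`, degree `4`; locator arXiv:2509.23403 Thm. 1.2
and Cor. 1.3). [claim: Markman2025SurveySecant, status: under-review] -/
theorem Markman2025_weilClasses_algebraic_abelianFourfold_of_dim_le_five
    (h : Markman2025_hodgeClasses_algebraic_abelian_dim_le_five) :
    Markman2025_weilClasses_algebraic_abelianFourfold := by
  intro d _ A φ hA hX _ c hc h22 _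
  refine h A (by omega) ?_ 2 c hc ?_
  · rw [hA]; exact hX
  · rw [hA]; exact h22

/-- The `dim ≤ 3` slice of the fact is the abelian instance of the tree's `dim ≤ 3` fact
`hodgeClasses_algebraic_of_dim_le_three` (Voisin II, proof of Prop. 10.26: Lefschetz `(1,1)` and
`L : H² ≅ H⁴`), so on curves, surfaces and threefolds the claim adds nothing to the refereed record.
[cite: VoisinHodgeII2003, §10.2.3 proof of Prop. 10.26] -/
theorem Markman2025_hodgeClasses_algebraic_abelian_dim_le_five.of_dim_le_three
    (h3 : hodgeClasses_algebraic_of_dim_le_three) (A : Motives.AbelianVariety ℂ) (hd : A.dim ≤ 3)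
    (hX : Motives.IsSmoothProjective A.dim A.X) (p : ℕ)
    (c : singularCohomology ℂ ℂ (Motives.ComplexPoints A.X) (2 * p)) (hc : IsRationalClass c)
    (hpp : IsOfHodgeType A.dim A.X (2 * p) p p c) : c ∈ algebraicClasses A.X p :=
  h3 hd hX p c hc hpp

/-- Sanity on the hypotheses: on a smooth projective abelian variety (which has a Hodge model under
`nonempty_hodgeModel`) the zero class of every even degree is rational, of type `(p,p)` and
algebraic, so the fact is consistent on its trivially inhabited instance. [folklore] -/
theorem zero_mem_algebraicClasses_abelian (A : Motives.AbelianVariety ℂ)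
    (hM : nonempty_hodgeModel A.dim A.X) (hX : Motives.IsSmoothProjective A.dim A.X) (p : ℕ) :
    IsRationalClass (0 : singularCohomology ℂ ℂ (Motives.ComplexPoints A.X) (2 * p)) ∧
      IsOfHodgeType A.dim A.X (2 * p) p p 0 ∧
      (0 : singularCohomology ℂ ℂ (Motives.ComplexPoints A.X) (2 * p)) ∈ algebraicClasses A.X p :=
  ⟨IsRationalClass.zero, isOfHodgeType_zero_of_isSmoothProjective hM hX (2 * p) p p,
    Submodule.zero_mem _⟩

end HodgeTheory

end Literature.AlgebraicGeometry.HodgeTheory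

end
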